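import Mathlib
import Summits.Ventures.PercRepro2.CoinChainBlindGenLift

/-!
# The GENERAL AND-switch chain with head-blind non-entries — the theorem
(blind cell PercRepro2, night-2 g20; proofs/NIGHT2-DARC.md §60.8)

`chain_functional_nonneg_of_blind`: the chain functional of
`(ν · chainMix ent ent' ρ c d, ν · chainMix ent ent' ρ c d')` (`a` entered surely from `ent` and by
the coin from `a'`, `a'` surely from `ent'`) with ANY nonnegative increasing markers is
nonnegative whenever the head is blind to the non-entries `U ∖ (ent ∪ ent')`.

PROOF.  `gate_functional_nonneg` on `(insert x₀ U).powerset` with the sure entry set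
`insert x₀ ent` (`CoinChainBlindGenLemmas/Lift.lean`); summing out `x₀` returns the chain `R`-law
exactly and the chain gate minus `κ·ν·1_I`, `κ = ρ·(d ∅ − d' ∅)`, `I` the entry-free ideal
(`liftLawG_sum_R/_G`); the correction is `κ·Q ≥ 0` by FKG on `I` and the Holley comparison
`ν·1_I ≼ R` (`blindG_correction_nonneg`, exactly as in the pure case — the chain value does not
see an entry-free cluster joined on, `chainMixG_blind_union`).
-/

namespace Summit.Ventures.PercRepro2.Coin

open Classical

section ChainBlindGenMain

variable {V : Type*} [DecidableEq V] {R : Type*} [Field R] [LinearOrder R] [IsStrictOrderedRing R]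

omit [LinearOrder R] [IsStrictOrderedRing R] in
/-- **Summing out the virtual vertex.** -/
lemma liftLawG_sum (U ent ent' : Finset V) (x₀ : V) (hx₀ : x₀ ∉ U) (ρ : R) (ν c d e : Finset V → R)
    (J : Finset V → R) :
    ∑ W' ∈ (insert x₀ U).powerset, liftLawG U ent ent' x₀ ρ ν c d e W' * J (W' ∩ U) =
      ∑ W ∈ U.powerset, ν W * (offG ent ent' ρ c d e W + ρ * e W) * J W := by
  rw [Finset.sum_powerset_insert hx₀, ← Finset.sum_add_distrib]
  refine Finset.sum_congr rfl fun W hW => ?_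
  rw [Finset.mem_powerset] at hW
  have hx₀W : x₀ ∉ W := fun h => hx₀ (hW h)
  have h1 : W ∩ U = W := Finset.inter_eq_left.mpr hW
  have h2 : insert x₀ W ∩ U = W := by rw [Finset.insert_inter_of_notMem hx₀, h1]
  unfold liftLawG
  rw [h1, h2, if_neg hx₀W, if_pos (Finset.mem_insert_self _ _)]
  ring

omit [LinearOrder R] [IsStrictOrderedRing R] in
/-- The lifted `R`-law sums to the general chain `R`-law. -/
lemma liftLawG_sum_R (U ent ent' : Finset V) (x₀ : V) (hx₀ : x₀ ∉ U) (ρ : R) (ν c d : Finset V → R)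
    (J : Finset V → R) :
    ∑ W' ∈ (insert x₀ U).powerset, liftLawG U ent ent' x₀ ρ ν c d d W' * J (W' ∩ U) =
      ∑ W ∈ U.powerset, ν W * chainMix ent ent' ρ c d W * J W := by
  rw [liftLawG_sum U ent ent' x₀ hx₀ ρ ν c d d J]
  refine Finset.sum_congr rfl fun W _ => ?_
  rw [offG_add]; ring

omit [LinearOrder R] [IsStrictOrderedRing R] in
/-- The lifted gate sums to the general chain gate minus `κ = ρ·(d ∅ − d' ∅)` times the
entry-free `ν`-moment (blindness). -/
lemma liftLawG_sum_G (U ent ent' : Finset V) (x₀ : V) (hx₀ : x₀ ∉ U) (ρ : R)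
    (ν c d d' : Finset V → R)
    (hbd : ∀ W, d W = d (W ∩ (ent ∪ ent'))) (hbd' : ∀ W, d' W = d' (W ∩ (ent ∪ ent')))
    (J : Finset V → R) :
    ∑ W' ∈ (insert x₀ U).powerset, liftLawG U ent ent' x₀ ρ ν c d d' W' * J (W' ∩ U) =
      ∑ W ∈ U.powerset, ν W * chainMix ent ent' ρ c d' W * J W -
        ρ * (d ∅ - d' ∅) *
          ∑ W ∈ U.powerset, ν W * (if ∃ r ∈ ent ∪ ent', r ∈ W then (0 : R) else 1) * J W := by
  rw [liftLawG_sum U ent ent' x₀ hx₀ ρ ν c d d' J, Finset.mul_sum, ← Finset.sum_sub_distrib]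
  refine Finset.sum_congr rfl fun W _ => ?_
  rw [offG_add]
  by_cases hW : ∃ r ∈ ent ∪ ent', r ∈ W
  · rw [if_pos hW]; ring
  · rw [if_neg hW, hbd W, hbd' W, inter_ent_eq_empty_of_not hW]; ring

omit [LinearOrder R] [IsStrictOrderedRing R] in
/-- With blindness the general chain value does not see an entry-free cluster joined on. -/
lemma chainMixG_blind_union (ent ent' : Finset V) (ρ : R) (c d : Finset V → R)
    (hbc : ∀ W, c W = c (W ∩ (ent ∪ ent'))) (hbd : ∀ W, d W = d (W ∩ (ent ∪ ent')))
    {s t : Finset V} (hs : ¬ ∃ r ∈ ent ∪ ent', r ∈ s) :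
    chainMix ent ent' ρ c d (s ∪ t) = chainMix ent ent' ρ c d t := by
  have hs1 : ¬ ∃ r ∈ ent, r ∈ s := fun ⟨r, hr, hrs⟩ => hs ⟨r, Finset.mem_union_left _ hr, hrs⟩
  have hs2 : ¬ ∃ r ∈ ent', r ∈ s := fun ⟨r, hr, hrs⟩ => hs ⟨r, Finset.mem_union_right _ hr, hrs⟩
  unfold chainMix chainTheta
  rw [blindG_union_of_not ent ent' c hbc hs, blindG_union_of_not ent ent' d hbd hs]
  have hu1 : (∃ r ∈ ent, r ∈ s ∪ t) ↔ (∃ r ∈ ent, r ∈ t) := by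
    rw [meets_union_iff]; exact ⟨fun h => h.resolve_left hs1, Or.inr⟩
  have hu2 : (∃ r ∈ ent', r ∈ s ∪ t) ↔ (∃ r ∈ ent', r ∈ t) := by
    rw [meets_union_iff]; exact ⟨fun h => h.resolve_left hs2, Or.inr⟩
  by_cases h1 : ∃ r ∈ ent, r ∈ t
  · rw [if_pos (hu1.2 h1), if_pos h1]
  · rw [if_neg (fun h => h1 (hu1.1 h)), if_neg h1]
    by_cases h2 : ∃ r ∈ ent', r ∈ t
    · rw [if_pos (hu2.2 h2), if_pos h2]
    · rw [if_neg (fun h => h2 (hu2.1 h)), if_neg h2]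

/-- The general chain value is nonnegative. -/
lemma chainMixG_nonneg (ent ent' : Finset V) (ρ : R) (c d : Finset V → R) (hρ0 : 0 ≤ ρ) (hρ1 : ρ ≤ 1)
    (hc0 : ∀ W, 0 ≤ c W) (hd0 : ∀ W, 0 ≤ d W) (hdc : ∀ W, d W ≤ c W) (W : Finset V) :
    0 ≤ chainMix ent ent' ρ c d W := by
  have h := offG_add ent ent' ρ c d d W
  have h' : chainMix ent ent' ρ c d W = offG ent ent' ρ c d d W + ρ * d W := by rw [h]; ring
  rw [h']
  exact add_nonneg (offG_nonneg ent ent' ρ c d d hρ0 hρ1 hc0 hd0 hd0 hdc W) (mul_nonneg hρ0 (hd0 W))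

/-- **The entry-free correction is nonnegative** (general chain): FKG for `ν` on the ideal and
the ideal means below the `R`-means. -/
lemma blindG_correction_nonneg (U ent ent' : Finset V) (ν c d : Finset V → R) (ρ : R)
    (hρ0 : 0 ≤ ρ) (hρ1 : ρ ≤ 1) (hν0 : ∀ W, 0 ≤ ν W)
    (hν : ∀ s ⊆ U, ∀ t ⊆ U, ν s * ν t ≤ ν (s ∩ t) * ν (s ∪ t))
    (hc0 : ∀ W, 0 ≤ c W) (hd0 : ∀ W, 0 ≤ d W) (hdc : ∀ W, d W ≤ c W)
    (hbc : ∀ W, c W = c (W ∩ (ent ∪ ent'))) (hbd : ∀ W, d W = d (W ∩ (ent ∪ ent')))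
    (x y : Finset V → R) (hx0 : ∀ W, 0 ≤ x W) (hy0 : ∀ W, 0 ≤ y W)
    (hxm : ∀ s t, x s ≤ x (s ∪ t)) (hym : ∀ s t, y s ≤ y (s ∪ t)) :
    0 ≤ (∑ W ∈ U.powerset, ν W * chainMix ent ent' ρ c d W) ^ 2 *
          (∑ W ∈ U.powerset, ν W * (if ∃ r ∈ ent ∪ ent', r ∈ W then (0 : R) else 1) * (x W * y W))
        - (∑ W ∈ U.powerset, ν W * chainMix ent ent' ρ c d W) *
          (∑ W ∈ U.powerset, ν W * chainMix ent ent' ρ c d W * x W) *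
          (∑ W ∈ U.powerset, ν W * (if ∃ r ∈ ent ∪ ent', r ∈ W then (0 : R) else 1) * y W)
        - (∑ W ∈ U.powerset, ν W * chainMix ent ent' ρ c d W) *
          (∑ W ∈ U.powerset, ν W * chainMix ent ent' ρ c d W * y W) *
          (∑ W ∈ U.powerset, ν W * (if ∃ r ∈ ent ∪ ent', r ∈ W then (0 : R) else 1) * x W)
        + (∑ W ∈ U.powerset, ν W * chainMix ent ent' ρ c d W * x W) *
          (∑ W ∈ U.powerset, ν W * chainMix ent ent' ρ c d W * y W) *
          (∑ W ∈ U.powerset, ν W * (if ∃ r ∈ ent ∪ ent', r ∈ W then (0 : R) else 1)) := by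
  set ind : Finset V → R := fun W => if ∃ r ∈ ent ∪ ent', r ∈ W then (0 : R) else 1 with hind
  have hind0 : ∀ W, 0 ≤ ind W := fun W => by
    simp only [hind]; split_ifs <;> norm_num
  have hmix0 : ∀ W, 0 ≤ chainMix ent ent' ρ c d W :=
    chainMixG_nonneg ent ent' ρ c d hρ0 hρ1 hc0 hd0 hdc
  set Λ := ∑ W ∈ U.powerset, ν W * chainMix ent ent' ρ c d W with hΛ
  set Λ₁ := ∑ W ∈ U.powerset, ν W * chainMix ent ent' ρ c d W * x W with hΛ₁
  set Λ₂ := ∑ W ∈ U.powerset, ν W * chainMix ent ent' ρ c d W * y W with hΛ₂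
  set a := ∑ W ∈ U.powerset, ν W * ind W with ha
  set a₁ := ∑ W ∈ U.powerset, ν W * ind W * x W with ha₁
  set a₂ := ∑ W ∈ U.powerset, ν W * ind W * y W with ha₂
  set a₁₂ := ∑ W ∈ U.powerset, ν W * ind W * (x W * y W) with ha₁₂
  have hind_one : ∀ {W : Finset V}, ¬ (∃ r ∈ ent ∪ ent', r ∈ W) → ind W = 1 := fun h => by
    simp only [hind]; rw [if_neg h]
  have hind_zero : ∀ {W : Finset V}, (∃ r ∈ ent ∪ ent', r ∈ W) → ind W = 0 := fun h => by
    simp only [hind]; rw [if_pos h]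
  have hfkg : a₁ * a₂ ≤ a * a₁₂ := by
    refine ad_pointwise U (fun W => ν W * ind W * x W) (fun W => ν W * ind W * y W)
      (fun W => ν W * ind W) (fun W => ν W * ind W * (x W * y W))
      (fun W => mul_nonneg (mul_nonneg (hν0 W) (hind0 W)) (hx0 W))
      (fun W => mul_nonneg (mul_nonneg (hν0 W) (hind0 W)) (hy0 W))
      (fun W => mul_nonneg (hν0 W) (hind0 W))
      (fun W => mul_nonneg (mul_nonneg (hν0 W) (hind0 W)) (mul_nonneg (hx0 W) (hy0 W))) ?_
    intro s hs t ht
    by_cases hes : ∃ r ∈ ent ∪ ent', r ∈ s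
    · rw [hind_zero hes]
      have : 0 ≤ ν (s ∩ t) * ind (s ∩ t) * (ν (s ∪ t) * ind (s ∪ t) * (x (s ∪ t) * y (s ∪ t))) :=
        mul_nonneg (mul_nonneg (hν0 _) (hind0 _))
          (mul_nonneg (mul_nonneg (hν0 _) (hind0 _)) (mul_nonneg (hx0 _) (hy0 _)))
      nlinarith [this]
    by_cases het : ∃ r ∈ ent ∪ ent', r ∈ t
    · rw [hind_zero het]
      have : 0 ≤ ν (s ∩ t) * ind (s ∩ t) * (ν (s ∪ t) * ind (s ∪ t) * (x (s ∪ t) * y (s ∪ t))) :=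
        mul_nonneg (mul_nonneg (hν0 _) (hind0 _))
          (mul_nonneg (mul_nonneg (hν0 _) (hind0 _)) (mul_nonneg (hx0 _) (hy0 _)))
      nlinarith [this]
    have hei : ¬ ∃ r ∈ ent ∪ ent', r ∈ s ∩ t := not_meets_inter_left hes
    have heu : ¬ ∃ r ∈ ent ∪ ent', r ∈ s ∪ t := fun h => by
      rcases meets_union_iff.1 h with h' | h'
      · exact hes h'
      · exact het h'
    rw [hind_one hes, hind_one het, hind_one hei, hind_one heu]
    have h1 := hν s hs t ht
    have h2 : x s * y t ≤ x (s ∪ t) * y (s ∪ t) := by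
      have hy' : y t ≤ y (s ∪ t) := by rw [Finset.union_comm]; exact hym t s
      exact mul_le_mul (hxm s t) hy' (hy0 t) (hx0 _)
    calc ν s * 1 * x s * (ν t * 1 * y t) = (ν s * ν t) * (x s * y t) := by ring
      _ ≤ (ν (s ∩ t) * ν (s ∪ t)) * (x (s ∪ t) * y (s ∪ t)) :=
          mul_le_mul h1 h2 (mul_nonneg (hx0 _) (hy0 _)) (mul_nonneg (hν0 _) (hν0 _))
      _ = ν (s ∩ t) * 1 * (ν (s ∪ t) * 1 * (x (s ∪ t) * y (s ∪ t))) := by ring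
  have hideal : ∀ (z : Finset V → R), (∀ W, 0 ≤ z W) → (∀ s t, z s ≤ z (s ∪ t)) →
      (∑ W ∈ U.powerset, ν W * ind W * z W) * Λ ≤
        a * (∑ W ∈ U.powerset, ν W * chainMix ent ent' ρ c d W * z W) := by
    intro z hz0 hzm
    refine ad_pointwise U (fun W => ν W * ind W * z W) (fun W => ν W * chainMix ent ent' ρ c d W)
      (fun W => ν W * ind W) (fun W => ν W * chainMix ent ent' ρ c d W * z W)
      (fun W => mul_nonneg (mul_nonneg (hν0 W) (hind0 W)) (hz0 W))
      (fun W => mul_nonneg (hν0 W) (hmix0 W))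
      (fun W => mul_nonneg (hν0 W) (hind0 W))
      (fun W => mul_nonneg (mul_nonneg (hν0 W) (hmix0 W)) (hz0 W)) ?_
    intro s hs t ht
    by_cases hes : ∃ r ∈ ent ∪ ent', r ∈ s
    · rw [hind_zero hes]
      have : 0 ≤ ν (s ∩ t) * ind (s ∩ t) *
          (ν (s ∪ t) * chainMix ent ent' ρ c d (s ∪ t) * z (s ∪ t)) :=
        mul_nonneg (mul_nonneg (hν0 _) (hind0 _))
          (mul_nonneg (mul_nonneg (hν0 _) (hmix0 _)) (hz0 _))
      nlinarith [this]
    have hei : ¬ ∃ r ∈ ent ∪ ent', r ∈ s ∩ t := not_meets_inter_left hes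
    rw [hind_one hes, hind_one hei, chainMixG_blind_union ent ent' ρ c d hbc hbd hes]
    have h1 := hν s hs t ht
    have h2 : z s * chainMix ent ent' ρ c d t ≤ z (s ∪ t) * chainMix ent ent' ρ c d t :=
      mul_le_mul_of_nonneg_right (hzm s t) (hmix0 t)
    calc ν s * 1 * z s * (ν t * chainMix ent ent' ρ c d t)
        = (ν s * ν t) * (z s * chainMix ent ent' ρ c d t) := by ring
      _ ≤ (ν (s ∩ t) * ν (s ∪ t)) * (z (s ∪ t) * chainMix ent ent' ρ c d t) :=
          mul_le_mul h1 h2 (mul_nonneg (hz0 _) (hmix0 _)) (mul_nonneg (hν0 _) (hν0 _))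
      _ = ν (s ∩ t) * 1 * (ν (s ∪ t) * chainMix ent ent' ρ c d t * z (s ∪ t)) := by ring
  have hid₁ : a₁ * Λ ≤ a * Λ₁ := hideal x hx0 hxm
  have hid₂ : a₂ * Λ ≤ a * Λ₂ := hideal y hy0 hym
  have hΛ0 : 0 ≤ Λ := Finset.sum_nonneg fun W _ => mul_nonneg (hν0 W) (hmix0 W)
  have ha0 : 0 ≤ a := Finset.sum_nonneg fun W _ => mul_nonneg (hν0 W) (hind0 W)
  have hprod : 0 ≤ (Λ * a₁ - Λ₁ * a) * (Λ * a₂ - Λ₂ * a) :=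
    mul_nonneg_of_nonpos_of_nonpos (by linarith) (by linarith)
  have hsq : 0 ≤ Λ ^ 2 * (a * a₁₂ - a₁ * a₂) := mul_nonneg (sq_nonneg Λ) (by linarith)
  have haQ : 0 ≤ a * (Λ ^ 2 * a₁₂ - Λ * Λ₁ * a₂ - Λ * Λ₂ * a₁ + Λ₁ * Λ₂ * a) := by
    have : a * (Λ ^ 2 * a₁₂ - Λ * Λ₁ * a₂ - Λ * Λ₂ * a₁ + Λ₁ * Λ₂ * a) =
        Λ ^ 2 * (a * a₁₂ - a₁ * a₂) + (Λ * a₁ - Λ₁ * a) * (Λ * a₂ - Λ₂ * a) := by ring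
    rw [this]
    exact add_nonneg hsq hprod
  rcases eq_or_lt_of_le ha0 with ha | ha
  · have hzero : ∀ W ∈ U.powerset, ν W * ind W = 0 := by
      rw [← Finset.sum_eq_zero_iff_of_nonneg (fun W _ => mul_nonneg (hν0 W) (hind0 W))]
      exact ha.symm
    have e1 : a₁ = 0 := Finset.sum_eq_zero fun W hW => by rw [hzero W hW, zero_mul]
    have e2 : a₂ = 0 := Finset.sum_eq_zero fun W hW => by rw [hzero W hW, zero_mul]
    have e12 : a₁₂ = 0 := Finset.sum_eq_zero fun W hW => by rw [hzero W hW, zero_mul]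
    rw [e1, e2, e12, ← ha]
    ring_nf
    exact le_rfl
  · exact (mul_nonneg_iff_of_pos_left ha).1 haQ

/-- **THE GENERAL AND-SWITCH CHAIN WITH HEAD-BLIND NON-ENTRIES, ANY MARKERS.** -/
theorem chain_functional_nonneg_of_blind (U ent ent' : Finset V) (x₀ : V) (hx₀ : x₀ ∉ U)
    (hentU : ent ⊆ U)
    (ν c d d' : Finset V → R) (ρ : R) (hρ0 : 0 ≤ ρ) (hρ1 : ρ ≤ 1)
    (hν0 : ∀ W, 0 ≤ ν W) (hν : ∀ s ⊆ U, ∀ t ⊆ U, ν s * ν t ≤ ν (s ∩ t) * ν (s ∪ t))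
    (hc0 : ∀ W, 0 ≤ c W) (hd0 : ∀ W, 0 ≤ d W) (hd'0 : ∀ W, 0 ≤ d' W)
    (hdc : ∀ W, d W ≤ c W) (hd'd : ∀ W, d' W ≤ d W)
    (hcc : ∀ s t, c s * c t ≤ c (s ∩ t) * c (s ∪ t))
    (hdd : ∀ s t, d s * d t ≤ d (s ∩ t) * d (s ∪ t))
    (hd'd' : ∀ s t, d' s * d' t ≤ d' (s ∩ t) * d' (s ∪ t))
    (hdd' : ∀ s t, d s * d' t ≤ d (s ∩ t) * d' (s ∪ t))
    (hcd : ∀ s t, c s * d t ≤ c (s ∩ t) * d (s ∪ t))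
    (hcd' : ∀ s t, c s * d' t ≤ c (s ∩ t) * d' (s ∪ t))
    (hbc : ∀ W, c W = c (W ∩ (ent ∪ ent'))) (hbd : ∀ W, d W = d (W ∩ (ent ∪ ent')))
    (hbd' : ∀ W, d' W = d' (W ∩ (ent ∪ ent')))
    (x y : Finset V → R) (hx0 : ∀ W, 0 ≤ x W) (hy0 : ∀ W, 0 ≤ y W)
    (hxm : ∀ s t, x s ≤ x (s ∪ t)) (hym : ∀ s t, y s ≤ y (s ∪ t)) :
    0 ≤ (∑ W ∈ U.powerset, ν W * chainMix ent ent' ρ c d W) ^ 2 *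
          (∑ W ∈ U.powerset, ν W * chainMix ent ent' ρ c d' W * (x W * y W))
        - (∑ W ∈ U.powerset, ν W * chainMix ent ent' ρ c d W) *
          (∑ W ∈ U.powerset, ν W * chainMix ent ent' ρ c d W * x W) *
          (∑ W ∈ U.powerset, ν W * chainMix ent ent' ρ c d' W * y W)
        - (∑ W ∈ U.powerset, ν W * chainMix ent ent' ρ c d W) *
          (∑ W ∈ U.powerset, ν W * chainMix ent ent' ρ c d W * y W) *
          (∑ W ∈ U.powerset, ν W * chainMix ent ent' ρ c d' W * x W)
        + (∑ W ∈ U.powerset, ν W * chainMix ent ent' ρ c d W * x W) *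
          (∑ W ∈ U.powerset, ν W * chainMix ent ent' ρ c d W * y W) *
          (∑ W ∈ U.powerset, ν W * chainMix ent ent' ρ c d' W) := by
  have hd'c : ∀ W, d' W ≤ c W := fun W => le_trans (hd'd W) (hdc W)
  have key := gate_functional_nonneg (insert x₀ U) (insert x₀ ent)
    (liftLawG U ent ent' x₀ ρ ν c d d) (liftLawG U ent ent' x₀ ρ ν c d d')
    (fun W' => x (W' ∩ U)) (fun W' => y (W' ∩ U))
    (liftLawG_nonneg U ent ent' x₀ ρ ν c d d hρ0 hρ1 hν0 hc0 hd0 hd0 hdc)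
    (liftLawG_nonneg U ent ent' x₀ ρ ν c d d' hρ0 hρ1 hν0 hc0 hd0 hd'0 hdc)
    (fun W' => hx0 _) (fun W' => hy0 _)
    (fun s t => by
      show x (s ∩ U) ≤ x ((s ∪ t) ∩ U)
      rw [state_union]; exact hxm _ _)
    (fun s t => by
      show y (s ∩ U) ≤ y ((s ∪ t) ∩ U)
      rw [state_union]; exact hym _ _)
    (fun s _ t _ => liftLawG_lsm U ent ent' x₀ ρ ν c d d hρ0 hρ1 hν0 hν hc0 hd0 hd0 hdc hdc hcc hdd
      hcd hbc hbd hbd s t)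
    (fun s _ t _ => liftLawG_lsm U ent ent' x₀ ρ ν c d d' hρ0 hρ1 hν0 hν hc0 hd0 hd'0 hdc hd'c hcc
      hd'd' hcd' hbc hbd hbd' s t)
    (fun s hsU t _ hs => by
      obtain ⟨r, hr, hrs⟩ := hs
      rw [Finset.mem_insert] at hr
      refine liftLawG_cross U ent ent' x₀ ρ ν c d d' hρ0 hρ1 hν0 hν hc0 hd0 hd'0 hdc hd'd hdd' hcd'
        hbc hbd hbd' s t ?_
      rcases hr with rfl | hr
      · exact Or.inl hrs
      · exact Or.inr ⟨r, hr, Finset.mem_inter.2 ⟨hrs, hentU hr⟩⟩)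
    (fun W' hW' => liftLawG_off U ent ent' x₀ ρ ν c d d' W' hW')
  have eΛ : ∑ W' ∈ (insert x₀ U).powerset, liftLawG U ent ent' x₀ ρ ν c d d W' =
      ∑ W ∈ U.powerset, ν W * chainMix ent ent' ρ c d W := by
    have h := liftLawG_sum_R U ent ent' x₀ hx₀ ρ ν c d (fun _ => (1 : R))
    simp only [mul_one] at h
    exact h
  have eΛ₁ := liftLawG_sum_R U ent ent' x₀ hx₀ ρ ν c d x
  have eΛ₂ := liftLawG_sum_R U ent ent' x₀ hx₀ ρ ν c d y
  have eM : ∑ W' ∈ (insert x₀ U).powerset, liftLawG U ent ent' x₀ ρ ν c d d' W' =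
      ∑ W ∈ U.powerset, ν W * chainMix ent ent' ρ c d' W -
        ρ * (d ∅ - d' ∅) *
          ∑ W ∈ U.powerset, ν W * (if ∃ r ∈ ent ∪ ent', r ∈ W then (0 : R) else 1) := by
    have h := liftLawG_sum_G U ent ent' x₀ hx₀ ρ ν c d d' hbd hbd' (fun _ => (1 : R))
    simp only [mul_one] at h
    exact h
  have eM₁ := liftLawG_sum_G U ent ent' x₀ hx₀ ρ ν c d d' hbd hbd' x
  have eM₂ := liftLawG_sum_G U ent ent' x₀ hx₀ ρ ν c d d' hbd hbd' y
  have eM₁₂ := liftLawG_sum_G U ent ent' x₀ hx₀ ρ ν c d d' hbd hbd' (fun W => x W * y W)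
  rw [eΛ, eΛ₁, eΛ₂, eM, eM₁, eM₂, eM₁₂] at key
  have hcorr := blindG_correction_nonneg U ent ent' ν c d ρ hρ0 hρ1 hν0 hν hc0 hd0 hdc hbc hbd
    x y hx0 hy0 hxm hym
  have hκ : 0 ≤ ρ * (d ∅ - d' ∅) := mul_nonneg hρ0 (by linarith [hd'd ∅])
  have hκcorr := mul_nonneg hκ hcorr
  set Λ := ∑ W ∈ U.powerset, ν W * chainMix ent ent' ρ c d W
  set Λ₁ := ∑ W ∈ U.powerset, ν W * chainMix ent ent' ρ c d W * x W
  set Λ₂ := ∑ W ∈ U.powerset, ν W * chainMix ent ent' ρ c d W * y W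
  set M := ∑ W ∈ U.powerset, ν W * chainMix ent ent' ρ c d' W
  set M₁ := ∑ W ∈ U.powerset, ν W * chainMix ent ent' ρ c d' W * x W
  set M₂ := ∑ W ∈ U.powerset, ν W * chainMix ent ent' ρ c d' W * y W
  set M₁₂ := ∑ W ∈ U.powerset, ν W * chainMix ent ent' ρ c d' W * (x W * y W)
  set κ := ρ * (d ∅ - d' ∅)
  set a := ∑ W ∈ U.powerset, ν W * (if ∃ r ∈ ent ∪ ent', r ∈ W then (0 : R) else 1)
  set a₁ := ∑ W ∈ U.powerset, ν W * (if ∃ r ∈ ent ∪ ent', r ∈ W then (0 : R) else 1) * x W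
  set a₂ := ∑ W ∈ U.powerset, ν W * (if ∃ r ∈ ent ∪ ent', r ∈ W then (0 : R) else 1) * y W
  set a₁₂ := ∑ W ∈ U.powerset, ν W * (if ∃ r ∈ ent ∪ ent', r ∈ W then (0 : R) else 1) * (x W * y W)
  have : Λ ^ 2 * M₁₂ - Λ * Λ₁ * M₂ - Λ * Λ₂ * M₁ + Λ₁ * Λ₂ * M =
      (Λ ^ 2 * (M₁₂ - κ * a₁₂) - Λ * Λ₁ * (M₂ - κ * a₂) - Λ * Λ₂ * (M₁ - κ * a₁) +
        Λ₁ * Λ₂ * (M - κ * a)) +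
      κ * (Λ ^ 2 * a₁₂ - Λ * Λ₁ * a₂ - Λ * Λ₂ * a₁ + Λ₁ * Λ₂ * a) := by ring
  rw [this]
  exact add_nonneg key hκcorr

end ChainBlindGenMain

end Summit.Ventures.PercRepro2.Coin
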